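import Summits.NavierStokesRegularity.NavierStokesRegularity.Theorems.ScenarioCensusRowF1ax
import Summits.NavierStokesRegularity.NavierStokesRegularity.Theorems.DssFarFieldSlavingBlowupTypeIDssProfileSubcriticalStrain
import Summits.NavierStokesRegularity.NavierStokesRegularity.Theorems.DssFarFieldSlavingBlowupTypeIDssProfileSimilarityEnstrophyBeltramiLiouville
import Literature.Analysis.FluidPDE.BarkerPrange2020VorticityAlignmentTypeIHolds
import HarnessLib

/-!
# Census row F1, family «STRETCHED TOP» (F1sx ⊇ F1ss ⊇ F1rg; F1gsx; F1lb) — LINE «stretched-top» port, part 1/4: threshold hypotheses on the top,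
# the rows, the floor `CriticallyStretchedTop`, the residual `StretchingSlack` (≡ Row_F1), the split of `Row_F1`

Re-homed for the scenario census (typer seat ns-census-typer-1 g7; the cells F1sx ⊇ F1ss ⊇ F1rg, F1gsx, F1lb are MEMBERS OF RECORD «DECIDED IN KERNEL IN
FILES» of row F1 since census v1.68 (critic idea-crit-3 g6 PASS 19:59:58Z; ref ns-census-ref g8 PRE-CHECK ✓ §13.14 [2/6]; lit §21.20); this port makes
them TREE-decided): VERBATIM PORT of ns-idea-3 LINE 16 «stretched-top», `pub/ideators/ns-idea-3/lines/stretched-top/line-stretched-top.lean` sha16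
a94533c1db73adac (912 l., lean check rc 0, 0 sorry), split for the 400-line rule into `ScenarioCensusRowF1Stretched` (§1) → `…StretchedZoom` (§2–§3) →
`…StretchedTransfer` (§4) → `…StretchedTop` (§5 + census KEYS).  Lean text VERBATIM in namespace `…Theorems.ScenarioCensus.StretchedTop` (the line's
`…Cruxes.ScenarioCensusRowF1.StretchedTopLine` re-homed); port edits: `@[conjecture]` on the residual `StretchingSlack` (≡ `ScenarioCensus.Row_F1`, OPEN).

No census VALUE is moved here (row F1 stays OPEN-WITH-LINE; the members become TREE-decided by name); NS regularity is NOT proved; `Row_F1` is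
untouched (zero movement, `stretchingSlack_iff_rowF1`); no summit statement is proved by this file.
-/

-- the summit and its single problem share the name `NavierStokesRegularity` (D-0017 nested layout)
set_option linter.dupNamespace false

noncomputable section

open MeasureTheory Set Function Filter TopologicalSpace Metric
open scoped Topology NNReal ENNReal InnerProductSpace RealInnerProductSpace Laplacian

namespace Summit.NavierStokesRegularity.NavierStokesRegularity.Theorems.ScenarioCensus.StretchedTop

open Literature.Analysis Literature.Analysis.FluidPDE
open Summit.NavierStokesRegularity.NavierStokesRegularity.Theorems

/-- `ℝ³`. -/
abbrev E3 := EuclideanSpace ℝ (Fin 3)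

/-! ## §1 Threshold hypotheses on the top, the rows, the floor, the residual, the split of `Row_F1` -/

/-- **Subcritical (moving) speed level**: `Λ(t) √(T − t) → 0` as `t ↑ T`. -/
def IsSubcriticalLevel (T : ℝ) (Λ : ℝ → ℝ) : Prop :=
  Tendsto (fun t => Λ t * Real.sqrt (T - t)) (𝓝[<] T) (𝓝 0)

/-- **Sub-critical vortex stretching on the top at level `Λ`, constant `θ`**: eventually as `t ↑ T`, at
every `Λ t`-fast point, `(T − t) ⟪∇u(t,x) ω, ω⟫ ≤ θ ‖ω‖²` with `ω = curl u(t, x)` (stretching rate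
`σ ≤ θ/(T − t)` wherever `ω ≠ 0`; no condition where `ω = 0`). -/
def HasSubcriticalStretchingAt (T : ℝ) (Λ : ℝ → ℝ) (θ : ℝ) (u : ℝ → E3 → E3) : Prop :=
  ∀ᶠ t in 𝓝[<] T, ∀ x : E3, Λ t < ‖u t x‖ →
    (T - t) * ⟪fderiv ℝ (u t) x (curl (u t) x), curl (u t) x⟫_ℝ ≤ θ * ‖curl (u t) x‖ ^ 2

/-- **Sub-critical strain on the top**: eventually `(T − t) ⟪∇u(t,x) ξ, ξ⟫ ≤ θ ‖ξ‖²` for all `ξ` at every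
fast point (all principal strains `≤ θ/(T − t)`). -/
def HasSubcriticalStrainAt (T : ℝ) (Λ : ℝ → ℝ) (θ : ℝ) (u : ℝ → E3 → E3) : Prop :=
  ∀ᶠ t in 𝓝[<] T, ∀ x : E3, Λ t < ‖u t x‖ →
    ∀ ξ : E3, (T - t) * ⟪fderiv ℝ (u t) x ξ, ξ⟫_ℝ ≤ θ * ‖ξ‖ ^ 2

/-- **Slack strain (asymptotically rigid top)**: for every `ε > 0`, eventually
`(T − t) |⟪∇u(t,x) ξ, ξ⟫| ≤ ε ‖ξ‖²` for all `ξ` at every fast point. -/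
def HasSlackStrainAt (T : ℝ) (Λ : ℝ → ℝ) (u : ℝ → E3 → E3) : Prop :=
  ∀ ε : ℝ, 0 < ε → ∀ᶠ t in 𝓝[<] T, ∀ x : E3, Λ t < ‖u t x‖ →
    ∀ ξ : E3, (T - t) * |⟪fderiv ℝ (u t) x ξ, ξ⟫_ℝ| ≤ ε * ‖ξ‖ ^ 2

/-- **Lamb slack on the top**: for every `ε > 0`, eventually `(T − t)^{3/2} ‖ω × u‖ ≤ ε` at every fast
point (`(T − t) √(T − t)` is the scale-invariant weight of the Lamb vector). -/
def HasLambSlackAt (T : ℝ) (Λ : ℝ → ℝ) (u : ℝ → E3 → E3) : Prop :=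
  ∀ ε : ℝ, 0 < ε → ∀ᶠ t in 𝓝[<] T, ∀ x : E3, Λ t < ‖u t x‖ →
    (T - t) * Real.sqrt (T - t) * ‖cross (curl (u t) x) (u t x)‖ ≤ ε

/-- **Sub-critically stretched top**: some subcritical level, some `θ < 1`. -/
def HasSubcriticallyStretchedTop (T : ℝ) (u : ℝ → E3 → E3) : Prop :=
  ∃ Λ : ℝ → ℝ, IsSubcriticalLevel T Λ ∧ ∃ θ : ℝ, θ < 1 ∧ HasSubcriticalStretchingAt T Λ θ u

/-- **Sub-critical strain top**: some subcritical level, some `θ < 1`. -/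
def HasSubcriticalStrainTop (T : ℝ) (u : ℝ → E3 → E3) : Prop :=
  ∃ Λ : ℝ → ℝ, IsSubcriticalLevel T Λ ∧ ∃ θ : ℝ, θ < 1 ∧ HasSubcriticalStrainAt T Λ θ u

/-- **Rigid top**: some subcritical level with slack strain. -/
def HasRigidTop (T : ℝ) (u : ℝ → E3 → E3) : Prop :=
  ∃ Λ : ℝ → ℝ, IsSubcriticalLevel T Λ ∧ HasSlackStrainAt T Λ u

/-- **Lamb-slack top**: some subcritical level with Lamb slack. -/
def HasLambSlackTop (T : ℝ) (u : ℝ → E3 → E3) : Prop :=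
  ∃ Λ : ℝ → ℝ, IsSubcriticalLevel T Λ ∧ HasLambSlackAt T Λ u

/-- **Global sub-critical stretching** (level-free): some `θ < 1` with `(T − t) ⟪∇u ω, ω⟫ ≤ θ ‖ω‖²`
everywhere, eventually. -/
def HasSubcriticalStretching (T : ℝ) (u : ℝ → E3 → E3) : Prop :=
  ∃ θ : ℝ, θ < 1 ∧ ∀ᶠ t in 𝓝[<] T, ∀ x : E3,
    (T - t) * ⟪fderiv ℝ (u t) x (curl (u t) x), curl (u t) x⟫_ℝ ≤ θ * ‖curl (u t) x‖ ^ 2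

/-- Constant levels are subcritical. -/
theorem isSubcriticalLevel_const (T Λ : ℝ) : IsSubcriticalLevel T (fun _ => Λ) := by
  have h : Tendsto (fun t : ℝ => Λ * Real.sqrt (T - t)) (𝓝 T) (𝓝 (Λ * Real.sqrt (T - T))) :=
    ((continuous_const.sub continuous_id).sqrt.tendsto T).const_mul Λ
  rw [sub_self, Real.sqrt_zero, mul_zero] at h
  exact h.mono_left nhdsWithin_le_nhds

/-- Sub-critical strain gives sub-critical stretching (take `ξ = ω`). -/
theorem HasSubcriticalStrainAt.hasSubcriticalStretchingAt {T : ℝ} {Λ : ℝ → ℝ} {θ : ℝ}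
    {u : ℝ → E3 → E3} (h : HasSubcriticalStrainAt T Λ θ u) : HasSubcriticalStretchingAt T Λ θ u := by
  filter_upwards [h] with t ht x hx using ht x hx (curl (u t) x)

/-- Slack strain gives sub-critical strain with the constant `1/2`. -/
theorem HasSlackStrainAt.hasSubcriticalStrainAt {T : ℝ} {Λ : ℝ → ℝ} {u : ℝ → E3 → E3}
    (h : HasSlackStrainAt T Λ u) : HasSubcriticalStrainAt T Λ (1 / 2) u := by
  have hIio : ∀ᶠ t in 𝓝[<] T, t ∈ Iio T := self_mem_nhdsWithin
  filter_upwards [h (1 / 2) one_half_pos, hIio] with t ht htT x hx ξ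
  have hTt : 0 ≤ T - t := by
    have : t < T := htT
    linarith
  exact (mul_le_mul_of_nonneg_left (le_abs_self _) hTt).trans (ht x hx ξ)

/-- A sub-critical strain top is a sub-critically stretched top. -/
theorem HasSubcriticalStrainTop.hasSubcriticallyStretchedTop {T : ℝ} {u : ℝ → E3 → E3}
    (h : HasSubcriticalStrainTop T u) : HasSubcriticallyStretchedTop T u := by
  obtain ⟨Λ, hΛ, θ, hθ, hs⟩ := h
  exact ⟨Λ, hΛ, θ, hθ, hs.hasSubcriticalStretchingAt⟩

/-- A rigid top is a sub-critical strain top (`θ = 1/2`). -/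
theorem HasRigidTop.hasSubcriticalStrainTop {T : ℝ} {u : ℝ → E3 → E3} (h : HasRigidTop T u) :
    HasSubcriticalStrainTop T u := by
  obtain ⟨Λ, hΛ, hs⟩ := h
  exact ⟨Λ, hΛ, 1 / 2, by norm_num, hs.hasSubcriticalStrainAt⟩

/-- Global sub-critical stretching is a sub-critically stretched top (at the constant level `0`). -/
theorem HasSubcriticalStretching.hasSubcriticallyStretchedTop {T : ℝ} {u : ℝ → E3 → E3}
    (h : HasSubcriticalStretching T u) : HasSubcriticallyStretchedTop T u := by
  obtain ⟨θ, hθ, hs⟩ := h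
  refine ⟨fun _ => 0, isSubcriticalLevel_const T 0, θ, hθ, ?_⟩
  filter_upwards [hs] with t ht x _ using ht x

/-- **Criterion row F1sx** (Type I · no symmetry · Clay class · SUB-CRITICALLY STRETCHED TOP ⇒ extension past
`T`): the frame of `ScenarioCensus.Row_F1` verbatim plus `HasSubcriticallyStretchedTop T u`.  PROVED
(`rowF1sx_holds`). -/
def Row_F1sx : Prop :=
  ∀ (ν T : ℝ), 0 < ν → 0 < T →
    ∀ (u : ℝ → E3 → E3) (p : ℝ → E3 → ℝ),
    IsClassicalNSSolutionOn (Ico 0 T) ν 0 u p → IsLerayHopfOn T ν 0 (u 0) u →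
    HasRapidSpatialDecay (u 0) → IsTypeIBlowup u T → HasSubcriticallyStretchedTop T u →
    HasSmoothExtensionPast ν 0 u T

/-- **Criterion row F1ss** (… · SUB-CRITICAL STRAIN ON THE TOP ⇒ extension).  PROVED. -/
def Row_F1ss : Prop :=
  ∀ (ν T : ℝ), 0 < ν → 0 < T →
    ∀ (u : ℝ → E3 → E3) (p : ℝ → E3 → ℝ),
    IsClassicalNSSolutionOn (Ico 0 T) ν 0 u p → IsLerayHopfOn T ν 0 (u 0) u →
    HasRapidSpatialDecay (u 0) → IsTypeIBlowup u T → HasSubcriticalStrainTop T u →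
    HasSmoothExtensionPast ν 0 u T

/-- **Criterion row F1rg** (… · ASYMPTOTICALLY RIGID TOP ⇒ extension).  PROVED. -/
def Row_F1rg : Prop :=
  ∀ (ν T : ℝ), 0 < ν → 0 < T →
    ∀ (u : ℝ → E3 → E3) (p : ℝ → E3 → ℝ),
    IsClassicalNSSolutionOn (Ico 0 T) ν 0 u p → IsLerayHopfOn T ν 0 (u 0) u →
    HasRapidSpatialDecay (u 0) → IsTypeIBlowup u T → HasRigidTop T u →
    HasSmoothExtensionPast ν 0 u T

/-- **Criterion row F1gsx** (… · GLOBAL SUB-CRITICAL STRETCHING ⇒ extension).  PROVED. -/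
def Row_F1gsx : Prop :=
  ∀ (ν T : ℝ), 0 < ν → 0 < T →
    ∀ (u : ℝ → E3 → E3) (p : ℝ → E3 → ℝ),
    IsClassicalNSSolutionOn (Ico 0 T) ν 0 u p → IsLerayHopfOn T ν 0 (u 0) u →
    HasRapidSpatialDecay (u 0) → IsTypeIBlowup u T → HasSubcriticalStretching T u →
    HasSmoothExtensionPast ν 0 u T

/-- **Criterion row F1lb** (… · LAMB-SLACK TOP ⇒ extension).  PROVED (`rowF1lb_holds`). -/
def Row_F1lb : Prop :=
  ∀ (ν T : ℝ), 0 < ν → 0 < T →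
    ∀ (u : ℝ → E3 → E3) (p : ℝ → E3 → ℝ),
    IsClassicalNSSolutionOn (Ico 0 T) ν 0 u p → IsLerayHopfOn T ν 0 (u 0) u →
    HasRapidSpatialDecay (u 0) → IsTypeIBlowup u T → HasLambSlackTop T u →
    HasSmoothExtensionPast ν 0 u T

/-- **CRITICALLY STRETCHED TOP** (structural floor, maximal frame): a maximal classical Leray–Hopf solution
from a rapidly decaying datum blowing up at the Type-I rate has neither a sub-critically stretched top nor a
Lamb-slack top.  PROVED (`criticallyStretchedTop_holds`). -/
def CriticallyStretchedTop : Prop :=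
  ∀ (ν T : ℝ), 0 < ν → 0 < T →
    ∀ (u : ℝ → E3 → E3) (p : ℝ → E3 → ℝ),
    IsMaximalSmoothSolution ν 0 u p T → IsLerayHopfOn T ν 0 (u 0) u →
    HasRapidSpatialDecay (u 0) → IsTypeIBlowup u T →
    ¬ HasSubcriticallyStretchedTop T u ∧ ¬ HasLambSlackTop T u

/-- **Residual** (maximal frame): every Type-I Clay blow-up has global sub-critical stretching.  DECLARED ≡
row F1 (`stretchingSlack_iff_rowF1`); no movement on `Row_F1` is claimed. -/
@[conjecture] def StretchingSlack : Prop :=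
  ∀ (ν T : ℝ), 0 < ν → 0 < T →
    ∀ (u : ℝ → E3 → E3) (p : ℝ → E3 → ℝ),
    IsMaximalSmoothSolution ν 0 u p T → IsLerayHopfOn T ν 0 (u 0) u →
    HasRapidSpatialDecay (u 0) → IsTypeIBlowup u T → HasSubcriticalStretching T u

/-- F1sx contains F1ss. -/
theorem rowF1ss_of_rowF1sx (h : Row_F1sx) : Row_F1ss :=
  fun ν T hν hT u p hsol hLH hdec hTI hs =>
    h ν T hν hT u p hsol hLH hdec hTI hs.hasSubcriticallyStretchedTop

/-- F1ss contains F1rg. -/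
theorem rowF1rg_of_rowF1ss (h : Row_F1ss) : Row_F1rg :=
  fun ν T hν hT u p hsol hLH hdec hTI hs => h ν T hν hT u p hsol hLH hdec hTI hs.hasSubcriticalStrainTop

/-- F1sx contains F1gsx. -/
theorem rowF1gsx_of_rowF1sx (h : Row_F1sx) : Row_F1gsx :=
  fun ν T hν hT u p hsol hLH hdec hTI hs =>
    h ν T hν hT u p hsol hLH hdec hTI hs.hasSubcriticallyStretchedTop

/-- **The split**: criterion + residual ⇒ row F1 (by cases on extendability). -/
theorem rowF1_of (hD : Row_F1gsx) (hR : StretchingSlack) : ScenarioCensus.Row_F1 := by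
  unfold ScenarioCensus.Row_F1
  intro ν T hν hT u p hsol hLH hdec hTI
  by_contra hext
  exact hext (hD ν T hν hT u p hsol hLH hdec hTI (hR ν T hν hT u p ⟨hsol, hext⟩ hLH hdec hTI))

/-- The residual is a consequence of the row (vacuously: under `Row_F1` no maximal solution is Type I). -/
theorem stretchingSlack_of_rowF1 (h : ScenarioCensus.Row_F1) : StretchingSlack :=
  fun ν T hν hT u p hmax hLH hdec hTI => (hmax.2 (h ν T hν hT u p hmax.1 hLH hdec hTI)).elim

end Summit.NavierStokesRegularity.NavierStokesRegularity.Theorems.ScenarioCensus.StretchedTop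

end
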